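import Summits.QuantumFields.YangMills.Theorems.BalabanUVNodesC44IterMhOneStepFactors
import Literature.MathematicalPhysics.QuantumFieldTheory.Balaban1983to89.B7Prop9Flat
import HarnessLib

/-!
# (ℓa-C) ROAD B, FILE F4′-3b — ONE AVERAGING STEP, PART 2: THE RE-GAUGED ONE-STEP ESTIMATE
# `s_{j+1} ≤ (1+s_j)^L − 1 + 10⁶(φ+λ)² + 14000·ε(φ+λ)` — the coarse-site drift `Φ(y) − Ad_{W(c)}Φ(y′)` is absorbed by the block gauge factor `H = eml{D(Γ)}`

Cell `pub-ymgap` ∕ `ym-nodeO-ideate`, porter lineage `ymgap-nodeO-port-PTB-1` (gen 7), hand «(44) for `iterMh`» (director-ym g22 №569/№571; PORT-PLAN-v5 dc7ff9950b0ac185,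
§ F4′-3).  `--kind proof --supports stmt-QuantumFields-27238 --as helper`; count-neutral.  [B7] = [Balaban1985Averaging]; [B11] = [Balaban1985Variational]; [I] = [Balaban1987RG1].

THE MATHEMATICS ([B7] Sect. B∕D «the tree-contour terms cancel against the moving frames», complex sup-norm edition).  With F4′-3a: `log corrMh Ṽ c = m₀ + b`, `m₀ = mean log ω`
(`E := corrM W c = e^{m₀}` unitary, `‖E − 1‖ ≤ 12ε`), `b = Φ(y) + T − Ad_{W(c)}Φ(y′) − (D(c) − 1) + O((φ+λ)² + ε(φ+λ))`.  Define the BLOCK GAUGE FACTOR `H(z) := eml{D(Γ^{σ_i}_{z,x_i})}_i`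
— determinant one (✓`det_eml_eq_one`: `det D(Γ) = 1`), `H = 1 + Φ + O(φ²)` (✓`norm_eml_one_add_sub_sub_mean_le`) — and the RE-GAUGED field `Ṽ′(c) := H(y)⁻¹·Ū_h(Ṽ)(c)·H(y′)`.  Then
`Ṽ′(c)·Ū(W)(c)⋆ = H(y)⁻¹ · [e^{m₀+b}e^{−m₀}] · [e^{m₀}·(D(c)·W(c)H(y′)W(c)⋆)·e^{−m₀}]` and to first order the three factors contribute `−Φ(y)`, `b`, `(D(c)−1) + Ad_{W(c)}Φ(y′)`: everything
cancels except the LINE TERM `T` (`‖T‖ ≤ (1+s)^L − 1`, coefficient exactly `L`).  Lit by name: ✓`B7Prop9Flat.norm_mlog_exp_add_mul_exp_neg_sub_le` (`log(e^{X+Y}e^{−Y}) = X + O(|X||Y|)`),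
✓`norm_exp_sub_one_sub_self_le`, ✓`norm_eml_add_sub_eml_le`, ✓`eml_mem_unitaryGroup`, ✓`det_eml_eq_one`, F4′-2a's four-factor lemma.

WHAT IS PROVED (0 def, 0 sorry, axioms standard; ns `Summit.QuantumFields.YangMills.Theorems.C44IterMh`; the three factors' bookkeeping is F4′-3b-i ✓`…C44IterMhOneStepFactors`).
* §4 generic pieces: `G1_bounds` (`G₁ = e^{b+m₀}e^{−m₀}`: `‖log G₁ − b‖ ≤ 3‖b‖‖m₀‖` by lit ✓`B7Prop9Flat.norm_mlog_exp_add_mul_exp_neg_sub_le`, `‖G₁ − 1‖ ≤ 4‖b‖`, `‖G₁ − 1 − log G₁‖ ≤ (2‖b‖)²`),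
  `X0_bounds` (`X₀ = D·(UH₂U⋆)` to first order), `G2_bound` (`‖EX₀E⁻¹ − X₀‖`), ★ `telescoping_assembly` (the drift `Φ₁`, `Ad_{W(c)}Φ₂` and the segment term CANCEL; only `T` survives).
* §5 ★★★ `norm_regauged_avgMh_sub_one_le` — THE ONE-STEP ESTIMATE for `H(y)⁻¹·Ū_h(Ṽ)(c)·H(y′)·Ū_h(W)(c)⋆`; ★★★ `exists_regauge` — the packaged step: `∃ H Ṽ′`, `det H = 1`, `‖H − 1‖ ≤ 2φ`,
  `Ū_h(Ṽ) = H • Ṽ′`, `det Ṽ′ = 1`, `‖Ṽ′(c)Ū_h(W)(c)⋆ − 1‖ ≤ (1+s)^L − 1 + 1.2·10⁶(φ+λ)² + 1.3·10⁴ε(φ+λ)`, under `φ ≥ (1+2s)^{dL} − 1`, `λ ≥ (1+2s)^L − 1`, `φ + λ ≤ 10⁻⁶`,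
  `ε ≤ 1∕50`, `N(7(φ+λ) + ε) ≤ 3`.

HONEST FRAMING.  A genuine estimate, but only ONE step of [B7]'s k-fold analysis, with crude constants; the k-uniform induction is F4′-4.  Nothing of [B11] (44)'s constant is asserted
beyond what is proved.  (ℓa-C)(ℓa-H)(ℓd) DISPLAYED; (R1)∕(R2) OPEN; K0ᴬ ⟨stmt-QuantumFields-27238⟩ NOT closed; K0ᴬ∕K1ᴬ∕K3ᴬ 0∕3; NODE O 0∕1; COUNT 8∕28 · K 1∕4 UNMOVED; finite
`𝕋⁴_{L^K}` at fixed ε — NOT continuum ∕ ℝ⁴ ∕ OS; **the Yang–Mills mass gap (Clay) is NOT proved by any of this.**  No `sorry`, `instance`, `notation`, `set_option`; standard axioms.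
-/

noncomputable section

open scoped Matrix Matrix.Norms.L2Operator

namespace Summit.QuantumFields.YangMills.Theorems.C44IterMh

open Literature.MathematicalPhysics.QuantumFieldTheory.Balaban1983to89
open Literature.MathematicalPhysics.QuantumFieldTheory.Balaban1983to89.Node00
open T4Continuum BlockAveraging
open B15AveragingHolomorphic (stepMh holMh holMh_nil holMh_cons loopMh corrMh axialMh avgMh avgMh_coeField loopMh_coeField)
open B7TransferAnalyticMean (meanCLM meanCLM_apply norm_meanCLM_apply_le norm_exp_sub_one_le_two_mul norm_exp_sub_one_sub_self_le)
open BlockAveragingEMLAnalyticMean (isAnalyticMean_eml eml_eq_exp_meanCLM eml_one norm_eml_add_sub_eml_le norm_eml_one_add_sub_sub_mean_le)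
open MatrixLog (mlog exp_mlog norm_mlog_le_two_mul)
open ExpMeanLog (eml)
open NormedSpace (exp)

variable {P : Params} {j : ℕ} {N : ℕ} [NeZero N]

/-! ## §4  Generic pieces of the assembly -/

section GenericPieces

omit [NeZero N]

/-- **The factor `G₁ = e^{b+m₀}e^{−m₀}`**: for `‖b‖ ≤ 1∕10`, `‖m₀‖ ≤ 1∕25`: `‖log G₁ − b‖ ≤ 3‖b‖‖m₀‖` (lit ✓`B7Prop9Flat.norm_mlog_exp_add_mul_exp_neg_sub_le`), `‖G₁ − 1‖ ≤ 4‖b‖`,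
`‖G₁ − 1 − log G₁‖ ≤ (2‖b‖)²`. [cite: Balaban1985Averaging, (21)–(23) p.21] -/
theorem G1_bounds [NeZero N] {b m₀ : Matrix (Fin N) (Fin N) ℂ} (hb : ‖b‖ ≤ 1 / 10) (hm : ‖m₀‖ ≤ 1 / 25) :
    ‖mlog (exp (b + m₀) * exp (-m₀)) - b‖ ≤ 3 * ‖b‖ * ‖m₀‖ ∧ ‖exp (b + m₀) * exp (-m₀) - 1‖ ≤ 4 * ‖b‖ ∧
      ‖exp (b + m₀) * exp (-m₀) - 1 - mlog (exp (b + m₀) * exp (-m₀))‖ ≤ (2 * ‖b‖) ^ 2 := by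
  haveI : Nonempty (Fin N) := ⟨⟨0, Nat.pos_of_ne_zero (NeZero.ne N)⟩⟩
  have hb0 := norm_nonneg b
  have hm0 := norm_nonneg m₀
  have he₂ := B7Prop9Flat.norm_mlog_exp_add_mul_exp_neg_sub_le hb hm
  have hG1 : ‖exp (b + m₀) * exp (-m₀) - 1‖ ≤ (1 + 2 * (‖b‖ + ‖m₀‖)) * (1 + 2 * ‖m₀‖) - 1 := by
    refine norm_mul_sub_one_le_of_le₂ ?_ ?_
    · exact norm_exp_sub_one_le_two_mul ((norm_add_le _ _).trans (by linarith)) |>.trans (by linarith [norm_add_le b m₀])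
    · exact (norm_exp_sub_one_le_two_mul (by rw [norm_neg]; linarith)).trans (by rw [norm_neg])
  have hGlt : ‖exp (b + m₀) * exp (-m₀) - 1‖ < 1 := lt_of_le_of_lt hG1 (by nlinarith)
  have hGexp : exp (b + m₀) * exp (-m₀) = exp (mlog (exp (b + m₀) * exp (-m₀))) := (exp_mlog hGlt).symm
  have hY : ‖mlog (exp (b + m₀) * exp (-m₀))‖ ≤ 2 * ‖b‖ := by
    have := norm_le_insert' (mlog (exp (b + m₀) * exp (-m₀))) b
    have h3 : 3 * ‖b‖ * ‖m₀‖ ≤ 3 * ‖b‖ * (1 / 25) := mul_le_mul_of_nonneg_left hm (by positivity)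
    linarith
  refine ⟨he₂, ?_, ?_⟩
  · rw [hGexp]
    exact (norm_exp_sub_one_le_two_mul (hY.trans (by linarith))).trans (by linarith)
  · have h := norm_exp_sub_one_sub_self_le (mlog (exp (b + m₀) * exp (-m₀)))
    rw [← hGexp] at h
    refine h.trans ?_
    have hY1 : |‖mlog (exp (b + m₀) * exp (-m₀))‖| ≤ 1 := by rw [abs_of_nonneg (norm_nonneg _)]; linarith
    have hr := (abs_le.1 (Real.abs_exp_sub_one_sub_id_le hY1)).2
    nlinarith [norm_nonneg (mlog (exp (b + m₀) * exp (-m₀)))]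

/-- **The factor `X₀ = D·(UH₂U⋆)`** (straight segment times the rotated next-block gauge factor): `‖X₀ − 1‖ ≤ (1+l)(1+2φ) − 1` and, to first order,
`‖X₀ − 1 − ((D − 1) + UΦ₂U⋆)‖ ≤ 2lφ + 36φ²` when `‖D − 1‖ ≤ l`, `‖H₂ − 1‖ ≤ 2φ`, `‖H₂ − 1 − Φ₂‖ ≤ 36φ²`, `U` unitary. [cite: Balaban1985Averaging, (111)–(112) p.34] -/
theorem X0_bounds {U D H₂ Φ₂ : Matrix (Fin N) (Fin N) ℂ} (hU : U ∈ Matrix.unitaryGroup (Fin N) ℂ) {l φ : ℝ} (hD : ‖D - 1‖ ≤ l) (hH : ‖H₂ - 1‖ ≤ 2 * φ)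
    (hHΦ : ‖H₂ - 1 - Φ₂‖ ≤ 36 * φ ^ 2) :
    ‖D * (U * H₂ * star U) - 1‖ ≤ (1 + l) * (1 + 2 * φ) - 1 ∧ ‖D * (U * H₂ * star U) - 1 - ((D - 1) + U * Φ₂ * star U)‖ ≤ 2 * l * φ + 36 * φ ^ 2 := by
  have hl0 : 0 ≤ l := (norm_nonneg _).trans hD
  have hUU : U * star U = 1 := Unitary.mul_star_self_of_mem hU
  have h2 : ‖U * H₂ * star U - 1‖ ≤ 2 * φ := by rw [norm_unitary_conj_sub_one_eq hU]; exact hH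
  refine ⟨norm_mul_sub_one_le_of_le₂ hD h2, ?_⟩
  have hid : D * (U * H₂ * star U) - 1 - ((D - 1) + U * Φ₂ * star U) = (D - 1) * (U * H₂ * star U - 1) + U * (H₂ - 1 - Φ₂) * star U := by
    have h' : U * (H₂ - 1 - Φ₂) * star U = U * H₂ * star U - 1 - U * Φ₂ * star U := by
      rw [mul_sub, mul_sub, sub_mul, sub_mul, mul_one, hUU]
    rw [h']
    noncomm_ring
  rw [hid]
  have h1 : ‖(D - 1) * (U * H₂ * star U - 1)‖ ≤ l * (2 * φ) := (norm_mul_le _ _).trans (mul_le_mul hD h2 (norm_nonneg _) hl0)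
  have h2' : ‖U * (H₂ - 1 - Φ₂) * star U‖ ≤ 36 * φ ^ 2 := by rw [norm_unitary_conj hU]; exact hHΦ
  exact (norm_add_le_of_le h1 h2').trans (le_of_eq (by ring))

/-- **Conjugating `X₀` by the near-identity `E`**: `‖EX₀E⁻¹ − X₀‖ ≤ 4‖E − 1‖·‖X₀ − 1‖`-type bound (`EX₀E⁻¹ − X₀ = E(X₀−1)E⁻¹ − (X₀−1)`). [cite: Balaban1985Averaging, (56)–(57) p.27] -/
theorem G2_bound [NeZero N] {E X₀ : Matrix (Fin N) (Fin N) ℂ} (hE : IsUnit E.det) {p x : ℝ} (hp : ‖E - 1‖ ≤ p) (hp2 : p ≤ 1 / 2) (hx : ‖X₀ - 1‖ ≤ x) :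
    ‖E * X₀ * E⁻¹ - X₀‖ ≤ 4 * p * x := by
  have hp0 : 0 ≤ p := (norm_nonneg _).trans hp
  have hid : E * X₀ * E⁻¹ - X₀ = E * (X₀ - 1) * E⁻¹ - (X₀ - 1) := by
    rw [mul_sub, sub_mul, mul_one, Matrix.mul_nonsing_inv _ hE]; abel
  rw [hid]
  exact (norm_conj_inv_sub_self_le hE hp hp2 _).trans (mul_le_mul_of_nonneg_left hx (by positivity))

/-- **THE TELESCOPING ASSEMBLY** (pure bookkeeping): if the three factors `A, G₁, G₂` of `AG₁G₂` have first-order parts `−Φ₁`, `b` and `(D−1) + Ψ` up to the displayed errors, and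
`b = Φ₁ + T − Ψ − (D−1)` up to `r₄`, then `‖AG₁G₂ − 1‖ ≤ ‖T‖ + Σ errors` — the drift `Φ₁`, `Ψ = Ad_{W(c)}Φ₂` and the segment term `D − 1` CANCEL. [cite: Balaban1985Averaging, (124)–(126) p.36] -/
theorem telescoping_assembly {A G₁ G₂ X₀ Φ₁ Ψ D T Y b : Matrix (Fin N) (Fin N) ℂ} {r₀ r₁ r₂ r₃ r₄ r₅ r₆ r₇ : ℝ}
    (h₀ : ‖A * G₁ * G₂ - 1 - ((A - 1) + (G₁ - 1) + (G₂ - 1))‖ ≤ r₀) (h₁ : ‖A - 1 + Φ₁‖ ≤ r₁) (h₂ : ‖G₁ - 1 - Y‖ ≤ r₂) (h₃ : ‖Y - b‖ ≤ r₃)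
    (h₄ : ‖b - (Φ₁ + T - Ψ - (D - 1))‖ ≤ r₄) (h₅ : ‖G₂ - X₀‖ ≤ r₅) (h₆ : ‖X₀ - 1 - ((D - 1) + Ψ)‖ ≤ r₆) (h₇ : ‖T‖ ≤ r₇) :
    ‖A * G₁ * G₂ - 1‖ ≤ r₀ + r₁ + r₂ + r₃ + r₄ + r₅ + r₆ + r₇ := by
  have hsplit : A * G₁ * G₂ - 1 = (A * G₁ * G₂ - 1 - ((A - 1) + (G₁ - 1) + (G₂ - 1))) + (A - 1 + Φ₁) + (G₁ - 1 - Y) + (Y - b)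
      + (b - (Φ₁ + T - Ψ - (D - 1))) + (G₂ - X₀) + (X₀ - 1 - ((D - 1) + Ψ)) + T := by abel
  rw [hsplit]
  exact norm_add_le_of_le (norm_add_le_of_le (norm_add_le_of_le (norm_add_le_of_le (norm_add_le_of_le (norm_add_le_of_le (norm_add_le_of_le h₀ h₁) h₂) h₃) h₄) h₅) h₆) h₇

end GenericPieces

/-! ## §5  The re-gauged one-step estimate -/

/-- ★★★ **THE RE-GAUGED ONE-STEP ESTIMATE.**  For the block gauge factors `H(z) = eml{D(Γ^{σ_i}_{z,x_i})}_i` at `y = emb c₋`, `y′ = emb c₊`: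
`‖H(y)⁻¹ · Ū_h(Ṽ)(c) · H(y′) · Ū_h(W)(c)⋆ − 1‖ ≤ (1+s)^L − 1 + 1.2·10⁶(φ+λ)² + 1.3·10⁴·ε(φ+λ)` — the drift `Φ(y) − Ad_{W(c)}Φ(y′)` cancels to first order, only the line term
survives (coefficient exactly `L`), all other contributions are second order in `(φ+λ)` or of order `ε(φ+λ)` ([B7] (124)–(126) «the remaining terms are small because the functions
`g(−z), g⁻¹(z), e^{iz}` are equal to `1` for `z = 0`»). [cite: Balaban1985Averaging, (124)–(126) p.36, Proposition 3 p.36; Balaban1987RG1, (0.4)–(0.8) p.253] -/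
theorem norm_regauged_avgMh_sub_one_le (W : GaugeField P j (SU N)) {V : PBond P j → Matrix (Fin N) (Fin N) ℂ} (hdet : ∀ b, (V b).det = 1) {s φ lam ε : ℝ}
    (hs : ∀ b, ‖V b * star (W b : Matrix (Fin N) (Fin N) ℂ) - 1‖ ≤ s) (hφ : (1 + 2 * s) ^ (P.d * P.L) - 1 ≤ φ) (hlam : (1 + 2 * s) ^ P.L - 1 ≤ lam)
    (hε : ∀ c i, ‖loopM (coeField W) c i - 1‖ ≤ ε) (hκ : φ + lam ≤ 1 / 10 ^ 6) (hε50 : ε ≤ 1 / 50) (hN : (N : ℝ) * (7 * (φ + lam) + ε) ≤ 3) (c : PBond P (j + 1)) :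
    ‖(eml fun i : Idx P => holMh V (walk (emb c.src) (stairWord i.2.1 (off i.1))) * star (holM (coeField W) (walk (emb c.src) (stairWord i.2.1 (off i.1)))))⁻¹ *
        avgMh V c *
        eml (fun i : Idx P => holMh V (walk (emb c.tgt) (stairWord i.2.1 (off i.1))) * star (holM (coeField W) (walk (emb c.tgt) (stairWord i.2.1 (off i.1))))) *
        star (avgMh (coeField W) c) - 1‖
      ≤ ((1 + s) ^ P.L - 1) + 1200000 * (φ + lam) ^ 2 + 13000 * ε * (φ + lam) := by
  haveI : Nonempty (Fin N) := ⟨⟨0, Nat.pos_of_ne_zero (NeZero.ne N)⟩⟩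
  -- §a scalars
  have hs0 : 0 ≤ s := (norm_nonneg _).trans (hs ⟨emb c.src, c.dir⟩)
  have hε0 : 0 ≤ ε := (norm_nonneg _).trans (hε c (Classical.arbitrary _))
  have h1s : (1 : ℝ) ≤ 1 + 2 * s := by linarith
  have hφ0 : 0 ≤ φ := le_trans (by linarith [one_le_pow₀ h1s (n := P.d * P.L)]) hφ
  have hlam0 : 0 ≤ lam := le_trans (by linarith [one_le_pow₀ h1s (n := P.L)]) hlam
  have hκ0 : 0 ≤ φ + lam := by positivity
  have hκ1 : φ + lam ≤ 1 / 1000000 := hκ.trans (by norm_num)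
  have hφκ : φ ≤ φ + lam := by linarith only [hlam0]
  have hlamκ : lam ≤ φ + lam := by linarith only [hφ0]
  have hφ2 : φ ≤ 1 / 2 := by linarith only [hφκ, hκ1]
  have hlam2 : lam ≤ 1 / 2 := by linarith only [hlamκ, hκ1]
  have hσ : 3 * φ + 3 * lam ≤ 1 := by linarith only [hκ1]
  have hφ36 : φ ≤ 1 / 36 := by linarith only [hφκ, hκ1]
  have h24 : 7 * (φ + lam) + ε ≤ 1 / 24 := by linarith only [hκ1, hε50]
  have h3' : 7 * (φ + lam) + ε ≤ 1 / 3 := by linarith only [hκ1, hε50]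
  have hNπ : (N : ℝ) * (7 * (φ + lam) + ε) < Real.pi := lt_of_le_of_lt hN Real.pi_gt_three
  have hNφ : (N : ℝ) * φ < Real.pi := lt_of_le_of_lt (mul_le_mul_of_nonneg_left (by linarith only [hφκ, hκ0, hε0]) (Nat.cast_nonneg _)) hNπ
  have hε6 : ε ≤ 1 / 6 := by linarith only [hε50]
  have hs2 : s ≤ 1 / 2 := by
    have hL : 1 ≤ P.L := P.hL.2.le
    have h1 : (1 + 2 * s) ^ 1 ≤ (1 + 2 * s) ^ P.L := pow_le_pow_right₀ h1s hL
    rw [pow_one] at h1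
    linarith only [h1, hlam, hlam2]
  have hlam₁0 : 0 ≤ (1 + s) ^ P.L - 1 := by linarith only [one_le_pow₀ (by linarith only [hs0] : (1:ℝ) ≤ 1 + s) (n := P.L)]
  have hlam₁ : (1 + s) ^ P.L - 1 ≤ lam := by
    have : (1 + s) ^ P.L ≤ (1 + 2 * s) ^ P.L := pow_le_pow_left₀ (by linarith only [hs0]) (by linarith only [hs0]) _
    linarith only [this, hlam]
  -- the elementary products used at the end
  have hκκ : (φ + lam) * (φ + lam) ≤ (φ + lam) * (1 / 1000000) := mul_le_mul_of_nonneg_left hκ1 hκ0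
  have hεκ : ε * (φ + lam) ≤ 1 / 50 * (φ + lam) := mul_le_mul_of_nonneg_right hε50 hκ0
  have hεκ0 : 0 ≤ ε * (φ + lam) := mul_nonneg hε0 hκ0
  have hφφ : φ ^ 2 ≤ (φ + lam) ^ 2 := pow_le_pow_left₀ hφ0 hφκ 2
  have hlφ : ((1 + s) ^ P.L - 1) * φ ≤ (φ + lam) * (φ + lam) := mul_le_mul (hlam₁.trans hlamκ) hφκ hφ0 hκ0
  have hlφ2 : ((1 + s) ^ P.L - 1) * φ ≤ lam * (1 / 2) := mul_le_mul hlam₁ hφ2 hφ0 hlam0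
  -- §b the staircase families at `y` and `y′`
  have hF₁det : ∀ i : Idx P, (holMh V (walk (emb c.src) (stairWord i.2.1 (off i.1))) * star (holM (coeField W) (walk (emb c.src) (stairWord i.2.1 (off i.1))))).det = 1 :=
    fun i => det_dress_eq_one W hdet _
  have hF₂det : ∀ i : Idx P, (holMh V (walk (emb c.tgt) (stairWord i.2.1 (off i.1))) * star (holM (coeField W) (walk (emb c.tgt) (stairWord i.2.1 (off i.1))))).det = 1 :=
    fun i => det_dress_eq_one W hdet _
  have hF₁n : ∀ i : Idx P, ‖holMh V (walk (emb c.src) (stairWord i.2.1 (off i.1))) * star (holM (coeField W) (walk (emb c.src) (stairWord i.2.1 (off i.1)))) - 1‖ ≤ φ :=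
    fun i => (norm_dress_stair_sub_one_le W hdet hs hs2 _ _ _).trans hφ
  have hF₂n : ∀ i : Idx P, ‖holMh V (walk (emb c.tgt) (stairWord i.2.1 (off i.1))) * star (holM (coeField W) (walk (emb c.tgt) (stairWord i.2.1 (off i.1)))) - 1‖ ≤ φ :=
    fun i => (norm_dress_stair_sub_one_le W hdet hs hs2 _ _ _).trans hφ
  obtain ⟨hH₁inv44, hH₁inv4⟩ := norm_blockH_inv_sub_one_add_mean_le hF₁det hF₁n hφ36 hNφ
  have hH₂1 := norm_blockH_sub_one_le hF₂n hφ36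
  have hH₂Φ := norm_blockH_sub_one_sub_mean_le hF₂n (by linarith)
  have hΦ₂n := norm_blockPhi_le W hdet hs hs2 hφ (emb c.tgt)
  have hΦ₁n := norm_blockPhi_le W hdet hs hs2 hφ (emb c.src)
  -- §c the straight segment at `y`
  have hUℓ := holM_coeField_mem_unitaryGroup W (walk (emb c.src) (List.replicate P.L (c.dir, true)))
  have hDℓ := norm_dress_line_sub_one_le' W hs (emb c.src) c.dir
  have hT := norm_lineTerm_le W (V := V) hs c
  -- §d the background correction factor `E = e^{m₀}`
  have hEu := corrM_mem_unitaryGroup' W hε (by linarith) c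
  have hEunit : IsUnit (corrM (coeField W) c) :=
    ⟨⟨corrM (coeField W) c, star (corrM (coeField W) c), Unitary.mul_star_self_of_mem hEu, Unitary.star_mul_self_of_mem hEu⟩, rfl⟩
  have hEdet : IsUnit (corrM (coeField W) c).det := (Matrix.isUnit_iff_isUnit_det _).1 hEunit
  have hE1 := norm_corrM_sub_one_le W hε (by linarith) c
  have hm₀ := norm_meanLog_le W hε (by linarith) c
  have hEexp := corrM_eq_exp_meanLog W c
  have hEstar := star_corrM_eq_exp_neg W hε (by linarith) c
  have hElog := mlog_corrM_eq W hε (by linarith) c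
  have hEinv : (corrM (coeField W) c)⁻¹ = exp (-(meanCLM (Idx P) (Matrix (Fin N) (Fin N) ℂ) fun i => mlog (loopM (coeField W) c i))) := by
    rw [← hEstar]; exact Matrix.inv_eq_left_inv (Unitary.star_mul_self_of_mem hEu)
  -- §e the complex correction factor `corrMh Ṽ c = e^{m₀ + b}`
  have hC1 := norm_corrMh_sub_one_le W hdet hs hs2 hφ hlam hφ2 hlam2 hσ hε hε6 h24 c
  have hCexp : corrMh V c = exp (mlog (corrMh V c)) := (exp_mlog (lt_of_le_of_lt hC1 (by linarith))).symm
  have hkey := norm_mlog_corrMh_sub_sub_mean_le W hdet hs hs2 hφ hlam hφ2 hlam2 hσ (by linarith) hε (by linarith) c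
  have hlog := norm_mean_mlog_dress_sub_mean_le W hdet hs hs2 hφ hlam hφ2 hlam2 hσ (by linarith) c
  have hmain := norm_mean_dressLoop_sub_main_le W hdet hs hs2 hφ hlam hφ2 hlam2 hσ hε c
  rw [hElog] at hkey
  -- §f abstract the objects
  set F₁ : Idx P → Matrix (Fin N) (Fin N) ℂ := fun i => holMh V (walk (emb c.src) (stairWord i.2.1 (off i.1))) * star (holM (coeField W) (walk (emb c.src) (stairWord i.2.1 (off i.1)))) with hF₁eq
  set F₂ : Idx P → Matrix (Fin N) (Fin N) ℂ := fun i => holMh V (walk (emb c.tgt) (stairWord i.2.1 (off i.1))) * star (holM (coeField W) (walk (emb c.tgt) (stairWord i.2.1 (off i.1)))) with hF₂eq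
  set Φ₁ : Matrix (Fin N) (Fin N) ℂ := meanCLM (Idx P) (Matrix (Fin N) (Fin N) ℂ) (fun i => F₁ i - 1) with hΦ₁eq
  set Φ₂ : Matrix (Fin N) (Fin N) ℂ := meanCLM (Idx P) (Matrix (Fin N) (Fin N) ℂ) (fun i => F₂ i - 1) with hΦ₂eq
  set U : Matrix (Fin N) (Fin N) ℂ := holM (coeField W) (walk (emb c.src) (List.replicate P.L (c.dir, true))) with hUeq
  set D : Matrix (Fin N) (Fin N) ℂ := holMh V (walk (emb c.src) (List.replicate P.L (c.dir, true))) * star U with hDeq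
  set E : Matrix (Fin N) (Fin N) ℂ := corrM (coeField W) c with hEeq
  set m₀ : Matrix (Fin N) (Fin N) ℂ := meanCLM (Idx P) (Matrix (Fin N) (Fin N) ℂ) (fun i => mlog (loopM (coeField W) c i)) with hm₀eq
  set T : Matrix (Fin N) (Fin N) ℂ := meanCLM (Idx P) (Matrix (Fin N) (Fin N) ℂ) (fun i => holM (coeField W) (walk (emb c.src) (stairWord i.2.1 (off i.1))) *
      (holMh V (walk (walkEnd (emb c.src) (stairWord i.2.1 (off i.1))) (List.replicate P.L (c.dir, true))) *
        star (holM (coeField W) (walk (walkEnd (emb c.src) (stairWord i.2.1 (off i.1))) (List.replicate P.L (c.dir, true)))) - 1) *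
      star (holM (coeField W) (walk (emb c.src) (stairWord i.2.1 (off i.1))))) with hTeq
  set abar : Matrix (Fin N) (Fin N) ℂ := meanCLM (Idx P) (Matrix (Fin N) (Fin N) ℂ) (fun i => mlog (holMh V (walk (emb c.src) (loopWord P.L c.dir (off i.1) i.2.1 i.2.2)) * star (loopM (coeField W) c i))) with habar
  set dbar : Matrix (Fin N) (Fin N) ℂ := meanCLM (Idx P) (Matrix (Fin N) (Fin N) ℂ) (fun i => holMh V (walk (emb c.src) (loopWord P.L c.dir (off i.1) i.2.1 i.2.2)) * star (loopM (coeField W) c i) - 1) with hdbar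
  set C : Matrix (Fin N) (Fin N) ℂ := corrMh V c with hCeq
  set b : Matrix (Fin N) (Fin N) ℂ := mlog C - m₀ with hbeq
  -- §g `b` versus the main term
  have hbMAIN : ‖b - (Φ₁ + T - U * Φ₂ * star U - (D - 1))‖ ≤ 124607 * (φ + lam) ^ 2 + 10396 * ε * (φ + lam) := by
    have e1 : b - (Φ₁ + T - U * Φ₂ * star U - (D - 1)) = (mlog C - m₀ - abar) + (abar - dbar) + (dbar - (Φ₁ + T - U * Φ₂ * star U - (D - 1))) := by
      rw [hbeq]; abel
    rw [e1]
    refine (norm_add₃_le).trans ?_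
    have := add_le_add (add_le_add hkey hlog) hmain
    refine this.trans (le_of_eq ?_)
    ring
  have hΨ : ‖U * Φ₂ * star U‖ ≤ φ := by rw [norm_unitary_conj hUℓ]; exact hΦ₂n
  have hMAIN : ‖Φ₁ + T - U * Φ₂ * star U - (D - 1)‖ ≤ 2 * (φ + lam) := by
    have := norm_sub_le_of_le (norm_sub_le_of_le (norm_add_le_of_le hΦ₁n hT) hΨ) hDℓ
    linarith only [this, hlam₁]
  have hbn : ‖b‖ ≤ 211 * (φ + lam) := by
    have := norm_le_insert' b (Φ₁ + T - U * Φ₂ * star U - (D - 1))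
    have hq : 124607 * (φ + lam) ^ 2 + 10396 * ε * (φ + lam) ≤ 209 * (φ + lam) := by
      rw [pow_two]; linarith only [hκκ, hεκ, hκ0]
    linarith only [this, hbMAIN, hMAIN, hq]
  -- §h the three factors
  have hb0 := norm_nonneg b
  have hbm : ‖b‖ ≤ 1 / 10 := hbn.trans (by linarith only [hκ1])
  have hm₀' : ‖m₀‖ ≤ 1 / 25 := hm₀.trans (by linarith only [hε50])
  obtain ⟨he₂, hG₁3, hG₁2⟩ := G1_bounds hbm hm₀'
  obtain ⟨hX₀1', hX₀2⟩ := X0_bounds hUℓ hDℓ hH₂1 hH₂Φ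
  have hX₀1 : ‖D * (U * eml F₂ * star U) - 1‖ ≤ 3 * (φ + lam) := by
    refine hX₀1'.trans ?_
    have : (1 + ((1 + s) ^ P.L - 1)) * (1 + 2 * φ) - 1 = ((1 + s) ^ P.L - 1) + 2 * φ + 2 * (((1 + s) ^ P.L - 1) * φ) := by ring
    rw [this]
    linarith only [hlφ2, hlam₁, hφ0, hlam0]
  have hG₂ := G2_bound (X₀ := D * (U * eml F₂ * star U)) hEdet hE1 (by linarith only [hε50]) hX₀1
  -- §i the product `H₁⁻¹ · G₁ · G₂`
  have hee : exp (-m₀) * exp m₀ = 1 := by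
    letI : NormedAlgebra ℚ (Matrix (Fin N) (Fin N) ℂ) := NormedAlgebra.restrictScalars ℚ ℂ _
    rw [← NormedSpace.exp_add_of_commute (Commute.refl m₀).neg_left, neg_add_cancel, NormedSpace.exp_zero]
  have hprod : (eml F₁)⁻¹ * avgMh V c * eml F₂ * star (avgMh (coeField W) c)
      = (eml F₁)⁻¹ * (exp (b + m₀) * exp (-m₀)) * (E * (D * (U * eml F₂ * star U)) * E⁻¹) := by
    have havg : avgMh V c = C * (D * U) := by
      rw [hCeq, hDeq, hUeq, mul_assoc (holMh V (walk (emb c.src) (List.replicate P.L (c.dir, true)))), star_holM_mul_holM, mul_one]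
      rfl
    have havgW : avgMh (coeField W) c = E * U := by rw [avgMh_coeField]; rfl
    have hCbm : C = exp (b + m₀) := by rw [hbeq, sub_add_cancel]; exact hCexp
    rw [havg, havgW, star_mul, hCbm, hEstar, hEinv, hEexp,
      show (eml F₁)⁻¹ * (exp (b + m₀) * exp (-m₀)) * (exp m₀ * (D * (U * eml F₂ * star U)) * exp (-m₀))
        = (eml F₁)⁻¹ * exp (b + m₀) * (exp (-m₀) * exp m₀) * (D * (U * eml F₂ * star U)) * exp (-m₀) by simp only [mul_assoc],
      hee, mul_one]
    simp only [mul_assoc]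
  have hG₂1 : ‖E * (D * (U * eml F₂ * star U)) * E⁻¹ - 1‖ ≤ 3 * (φ + lam) + 4 * (12 * ε) * (3 * (φ + lam)) := by
    rw [← sub_add_sub_cancel _ (D * (U * eml F₂ * star U)) 1]
    exact (norm_add_le_of_le hG₂ hX₀1).trans (le_of_eq (by ring))
  have h4 := norm_mul4_sub_one_sub_sum_le hH₁inv4 hG₁3 hG₂1 (show ‖(1 : Matrix (Fin N) (Fin N) ℂ) - 1‖ ≤ 0 by rw [sub_self, norm_zero])
  rw [mul_one, sub_self, add_zero] at h4
  have hσsum : 4 * φ + 4 * ‖b‖ + (3 * (φ + lam) + 4 * (12 * ε) * (3 * (φ + lam))) + 0 ≤ 854 * (φ + lam) := by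
    have : 4 * (12 * ε) * (3 * (φ + lam)) = 144 * (ε * (φ + lam)) := by ring
    rw [this]
    linarith only [hφκ, hbn, hεκ, hκ0]
  have hσ0 : 0 ≤ 4 * φ + 4 * ‖b‖ + (3 * (φ + lam) + 4 * (12 * ε) * (3 * (φ + lam))) + 0 := by positivity
  have htail := prod4_sub_one_sub_sum_le_sq (by linarith only [hφ0] : 0 ≤ 4 * φ) (by positivity : 0 ≤ 4 * ‖b‖)
    (by positivity : 0 ≤ 3 * (φ + lam) + 4 * (12 * ε) * (3 * (φ + lam))) le_rfl (hσsum.trans (by linarith only [hκ1]))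
  rw [hprod]
  have hfin := telescoping_assembly (h4.trans htail) hH₁inv44 hG₁2 he₂ hbMAIN hG₂ hX₀2 hT
  refine hfin.trans ?_
  -- §j the numbers
  have hsq : (4 * φ + 4 * ‖b‖ + (3 * (φ + lam) + 4 * (12 * ε) * (3 * (φ + lam))) + 0) ^ 2 ≤ (854 * (φ + lam)) ^ 2 :=
    pow_le_pow_left₀ hσ0 hσsum 2
  have hb2 : (2 * ‖b‖) ^ 2 ≤ (422 * (φ + lam)) ^ 2 := pow_le_pow_left₀ (by positivity) (by linarith only [hbn]) 2
  have hbε : 3 * ‖b‖ * ‖m₀‖ ≤ 1266 * (ε * (φ + lam)) := by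
    have := mul_le_mul hbn hm₀ (norm_nonneg _) (by positivity : (0:ℝ) ≤ 211 * (φ + lam))
    have e : 211 * (φ + lam) * (2 * ε) = 422 * (ε * (φ + lam)) := by ring
    rw [e] at this
    nlinarith only [this, hεκ0]
  have e1 : 4 * (12 * ε) * (3 * (φ + lam)) = 144 * (ε * (φ + lam)) := by ring
  have e2 : (854 * (φ + lam)) ^ 2 = 729316 * (φ + lam) ^ 2 := by ring
  have e3 : (422 * (φ + lam)) ^ 2 = 178084 * (φ + lam) ^ 2 := by ring
  have e4 : (φ + lam) * (φ + lam) = (φ + lam) ^ 2 := by ring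
  rw [e2] at hsq
  rw [e3] at hb2
  rw [e4] at hlφ
  rw [e1]
  linarith only [hsq, hb2, hbε, hφφ, hlφ, hεκ0, hκ0, hlam₁0, sq_nonneg (φ + lam)]

/-- ★★★ **THE PACKAGED ONE-STEP: RE-GAUGE AND GO UP ONE LEVEL.**  Under the hypotheses of `norm_regauged_avgMh_sub_one_le` there are a block gauge `H : T^{(j+1)} → SL(N,ℂ)` with
`‖H − 1‖ ≤ 2φ` and a level-`(j+1)` field `Ṽ′` with `det Ṽ′ = 1`, `Ū_h(Ṽ)(c) = H(c₋)·Ṽ′(c)·H(c₊)⁻¹`, and `‖Ṽ′(c)·Ū_h(W)(c)⋆ − 1‖ ≤ (1+s)^L − 1 + 1.2·10⁶(φ+λ)² + 1.3·10⁴ε(φ+λ)`.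
[cite: Balaban1985Averaging, Proposition 3 p.36, (58) p.27; Balaban1987RG1, (0.4)–(0.8) p.253] -/
theorem exists_regauge (W : GaugeField P j (SU N)) {V : PBond P j → Matrix (Fin N) (Fin N) ℂ} (hdet : ∀ b, (V b).det = 1) {s φ lam ε : ℝ}
    (hs : ∀ b, ‖V b * star (W b : Matrix (Fin N) (Fin N) ℂ) - 1‖ ≤ s) (hφ : (1 + 2 * s) ^ (P.d * P.L) - 1 ≤ φ) (hlam : (1 + 2 * s) ^ P.L - 1 ≤ lam)
    (hε : ∀ c i, ‖loopM (coeField W) c i - 1‖ ≤ ε) (hκ : φ + lam ≤ 1 / 10 ^ 6) (hε50 : ε ≤ 1 / 50) (hN : (N : ℝ) * (7 * (φ + lam) + ε) ≤ 3) :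
    ∃ (H : Site P (j + 1) → Matrix (Fin N) (Fin N) ℂ) (V' : PBond P (j + 1) → Matrix (Fin N) (Fin N) ℂ),
      (∀ z, (H z).det = 1) ∧ (∀ z, ‖H z - 1‖ ≤ 2 * φ) ∧ (∀ c, avgMh V c = H c.src * V' c * (H c.tgt)⁻¹) ∧ (∀ c, (V' c).det = 1) ∧
      (∀ c, ‖V' c * star (avgMh (coeField W) c) - 1‖ ≤ ((1 + s) ^ P.L - 1) + 1200000 * (φ + lam) ^ 2 + 13000 * ε * (φ + lam)) := by
  -- scalars (as in the estimate)
  have hs0 : 0 ≤ s := by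
    obtain ⟨c⟩ : Nonempty (PBond P (j + 1)) := ⟨⟨default, ⟨0, P.hd⟩⟩⟩
    exact (norm_nonneg _).trans (hs ⟨emb c.src, c.dir⟩)
  have h1s : (1 : ℝ) ≤ 1 + 2 * s := by linarith
  have hφ0 : 0 ≤ φ := le_trans (by linarith [one_le_pow₀ h1s (n := P.d * P.L)]) hφ
  have hlam0 : 0 ≤ lam := le_trans (by linarith [one_le_pow₀ h1s (n := P.L)]) hlam
  have hκ1 : φ + lam ≤ 1 / 1000000 := hκ.trans (by norm_num)
  have hφ2 : φ ≤ 1 / 2 := by linarith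
  have hlam2 : lam ≤ 1 / 2 := by linarith
  have hσ : 3 * φ + 3 * lam ≤ 1 := by linarith
  have hφ36 : φ ≤ 1 / 36 := by linarith
  have hε0 : 0 ≤ ε := by
    obtain ⟨c⟩ : Nonempty (PBond P (j + 1)) := ⟨⟨default, ⟨0, P.hd⟩⟩⟩
    exact (norm_nonneg _).trans (hε c (Classical.arbitrary _))
  have h3' : 7 * (φ + lam) + ε ≤ 1 / 3 := by linarith
  have hNπ : (N : ℝ) * (7 * (φ + lam) + ε) < Real.pi := lt_of_le_of_lt hN Real.pi_gt_three
  have hNφ : (N : ℝ) * φ < Real.pi := lt_of_le_of_lt (mul_le_mul_of_nonneg_left (by linarith) (Nat.cast_nonneg _)) hNπ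
  have hε6 : ε ≤ 1 / 6 := by linarith
  have hs2 : s ≤ 1 / 2 := by
    have hL : 1 ≤ P.L := P.hL.2.le
    have : 2 * s ≤ (1 + 2 * s) ^ P.L - 1 := by
      calc 2 * s = (1 + 2 * s) ^ 1 - 1 := by ring
        _ ≤ (1 + 2 * s) ^ P.L - 1 := by linarith [pow_le_pow_right₀ h1s hL]
    linarith
  -- the objects
  let F : Site P (j + 1) → Idx P → Matrix (Fin N) (Fin N) ℂ := fun z i =>
    holMh V (walk (emb z) (stairWord i.2.1 (off i.1))) * star (holM (coeField W) (walk (emb z) (stairWord i.2.1 (off i.1))))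
  have hFdet : ∀ z i, (F z i).det = 1 := fun z i => det_dress_eq_one W hdet _
  have hFn : ∀ z i, ‖F z i - 1‖ ≤ φ := fun z i => (norm_dress_stair_sub_one_le W hdet hs hs2 _ _ _).trans hφ
  refine ⟨fun z => eml (F z), fun c => (eml (F c.src))⁻¹ * avgMh V c * eml (F c.tgt), fun z => blockH_det_eq_one (hFdet z) (hFn z) (by linarith) hNφ,
    fun z => norm_blockH_sub_one_le (hFn z) hφ36, fun c => ?_, fun c => ?_, fun c => norm_regauged_avgMh_sub_one_le W hdet hs hφ hlam hε hκ hε50 hN c⟩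
  · have h1 := sl_mul_inv_cancel (blockH_det_eq_one (hFdet c.src) (hFn c.src) (by linarith) hNφ)
    have h2 := sl_mul_inv_cancel (blockH_det_eq_one (hFdet c.tgt) (hFn c.tgt) (by linarith) hNφ)
    rw [show eml (F c.src) * ((eml (F c.src))⁻¹ * avgMh V c * eml (F c.tgt)) * (eml (F c.tgt))⁻¹
        = (eml (F c.src) * (eml (F c.src))⁻¹) * avgMh V c * (eml (F c.tgt) * (eml (F c.tgt))⁻¹) by simp only [mul_assoc], h1, h2, one_mul, mul_one]
  · rw [Matrix.det_mul, Matrix.det_mul, sl_det_inv_eq_one (blockH_det_eq_one (hFdet c.src) (hFn c.src) (by linarith) hNφ),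
      blockH_det_eq_one (hFdet c.tgt) (hFn c.tgt) (by linarith) hNφ, det_avgMh_eq_one_SL W hdet hs hs2 hφ hlam hφ2 hlam2 hσ hε hε6 h3' hNπ c, one_mul, one_mul]

end Summit.QuantumFields.YangMills.Theorems.C44IterMh

end
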